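import Summits.QuantumFields.YangMills.Theorems.UnitScaleTiltProp7AvgHessGaugeSpikeRowKnit
import Summits.QuantumFields.YangMills.Theorems.UnitScaleTiltProp7AvgSeqSpikeMass
import Summits.QuantumFields.YangMills.Theorems.UnitScaleTiltProp7QkPenaltyKernelRow
import Summits.QuantumFields.YangMills.Theorems.UnitScaleTiltProp7QTwSCentralTowerRows
import Literature.MathematicalPhysics.QuantumFieldTheory.Balaban1983to89.B6BlockDecayHjCovV1
import HarnessLib

/-!
# (q-gauge) SUPPLIER — **THE TWO (T2) LETTERS OF THE KNIT ✓`Prop7AvgHessGaugeSpikeRowKnit` DISCHARGED**: `hQrow` = THE SUP ROW OF THE AVERAGING OF RECORD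
# (`‖Q(U₀)Y(c)‖ ≤ 30·ℓ·sup‖Y‖`) and `hnK` = THE COARSE BOND-END MASS OF THE AVERAGED SITE SPIKE (`Σ_c (‖N⁽ᵏ⁾(ĉ₋)‖ + ‖N⁽ᵏ⁾(ĉ₊)‖) ≤ 6ℓ⁻³‖A‖`), so that the supplier of
# ✓p768852's gauge-spike row `hqG` is typed modulo EXACTLY the second-order identity `hId` (S1-SPEC (2), now in CONCRETE currency) and «FR₂-lite» `hκY`

Cell `ym3-torus` (HUMAN RULING D-0037, YM ladder rung R3 — SU(2) YM₃ on T³: NOT d = 4, NOT infinite volume, NOT a mass gap, NOT Clay).  Width seat `ym3-torus-px19` (gen 14);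
chair ★`ym-ust-19200-p1` g27 WORD №29 (2) «(q-gauge) → px19 g14».  THEOREMS ONLY (0 `def`, 0 `sorry`, default heartbeats); `--supports stmt-QuantumFields-19200 --as helper`; count-neutral.

THE PRINT.  [Balaban1985BackgroundPropagators] (3.13) p.392, (3.14)–(3.16) p.393 («Q_j(U)A is a linear part of the function (3.13)», the `L^∞` bound (3.16)), (3.19) p.393, (3.114)–(3.115) p.418;
[Balaban1985Averaging] (11) p.19, (97) p.32, Prop. 3 p.36, Prop. 5 (157) p.42; [Balaban1984PropagatorsI] (1.18) p.20 (`(Lʲ)^d·d` bonds over a unit site).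

THE MATHEMATICS.  (ROW) `QTwS U₀ Y (c) = Σ_b QTwS U₀ (δ_b ⊗ Y b)(c)`; only the bonds `b` whose source block is `ĉ₋` or `ĉ₊` are read (✓`Prop7QkPenaltyKernelRow.QTwS_single_eq_zero_of_not_read`),
at most `2·3ℓ³` of them ([Balaban1984PropagatorsI] (1.18), ✓`B6BlockDecayHjCovV1.card_fiber_src_iterBlockOf_le`), each by one term of the column letter (COL) ✓`Prop7QTwSColumnBound.col_of_regPr`
(`≤ C_Q·ℓ⁻²·‖Y b‖`, `C_Q ≤ 5` ✓`col_const_le_five`): `‖QTwS U₀ Y (c)‖ ≤ 5ℓ⁻²·6ℓ³·s = 30·ℓ·s` — print's (3.16) with the `ℓ = Lᵏ` of the unscaled chart.  (MASS) the averaging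
sequence `ns` of ✓`Prop7SymAvgTwSGaugeDir.QTwS_gaugeDir_of_avgSeq` (recursion (97) against the background tower `Ū₀♭ʲ = emlIterU j U₀♭`, which is `U1`-valued on `𝔘_k(ε₀)` —
✓`emlIterU_bgUnits_mem_U1_of_regPr`, ✓`holT_mem_U1`) contracts the site mass by `(L³)⁻¹` per level (✓`Prop7AvgSeqSpikeMass.sum_norm_avgStep_le`), so a site
spike `δ_x ⊗ A` has top-level mass `ℓ⁻³‖A‖`, and each coarse site is an end of `6` coarse bonds (✓`Prop7AvgHessGaugeT1Row.sum_norm_src_add_tgt_eq` on the member `F.P n`, carried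
along `bondShift`∕`siteShift`).

WHAT IS PROVED (member `F`, `h : n ≤ K`, background `U₀ ∈ 𝔘_k(ε₀)` in the (COL) windows `10¹⁰L⁶ε₀ ≤ 1`, `10¹²L³ε₀ ≤ 1`).
* §1 ★★ `norm_QTwS_apply_le_of_regPr` (`‖QTwS U₀ Y c‖ ≤ 30·(F.L:ℝ)^(K−n)·s` for `sup‖Y‖ ≤ s`), `norm_QTwS_le_of_regPr` (the same for the sup norm of `QTwS U₀ Y`) — the KNIT's
  `hQrow` with `MQ Y := ‖QTwS U₀ Y‖`, `CQ′ := 30`.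
* §2 ★★ `sum_norm_avgSeq_le_of_regPr` (mass contraction `Σ_y ‖ns k y‖ ≤ ((L³)⁻¹)^k·Σ_x ‖ns 0 x‖`, `k ≤ K − n`, NO unit-norm hypothesis left), ★★ `hnK_of_avgSeq_spike_of_regPr`
  (`ns 0 = δ_x ⊗ A` ⟹ `Σ_{c : PBond (F.P n) 0} (‖ns (K−n) ĉ.src‖ + ‖ns (K−n) ĉ.tgt‖) ≤ 6·((F.L:ℝ)^(K−n))⁻¹^3·‖A‖`) — the KNIT's `hnK` with `MN x A := Σ_c (‖N⁽ᵏ⁾(ĉ₋)‖ + ‖N⁽ᵏ⁾(ĉ₊)‖)`.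
* §3 ★★★ `gaugeDir_column_of_identity_and_FR2` ∕ ★★★ `hqG_member_of_identity_and_FR2` — the KNIT with §1–§2 plugged in and `C_Q ≤ 5`: from `hId` (CONCRETE: the norm reading of
  S1-SPEC (2) with `‖QTwS U₀ Y‖` and the `ns`-masses) and `hκY` («FR₂-lite», constant `C₃`) alone, `Σ_y ‖avgHess U₀ Y (gd δ_xA) y‖ ≤ (240 + C₃)·ℓ⁻²·s·‖A‖` and ✓p768852's member
  row `hQG` with `qG := η⁻¹·(240 + C₃)·ℓ⁻²`.
* §4 ★★★ `hqG_of_identity_and_FR2_family` — ✓p768852's DISPLAYED family hypothesis `hqG` VERBATIM with `qG L := 240 + C₃ L`, from the per-member letters, by ✓`hqG_of_gaugeDir_column_family`.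
HYP-SAT (★★OWNER RULING №42): `RegPr` + the (COL) windows (the literal families inhabit them); the averaging-sequence family `ns` is inhabited by the recursion itself (`Nat.rec`; cf.
✓`Prop7QkOntoOfRegPr`'s `exists_seed_of_covMeanTower`); `hId` is the norm reading of S1-SPEC (2) — OPEN (the `Y`-derivative of ✓`Prop7ChartGaugeCovarianceDeriv` at `A = 0`), displayed
honestly and NOT a restatement of the conclusion (it bounds the Hessian column by the three (T)-terms, not by `ℓ⁻²`); `hκY` = «FR₂-lite» — OPEN; tested at `Y = 0`: every letter forces only
`0 ≤ const`; nothing eventual.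
HONEST SCOPE.  Row∕mass bookkeeping; nothing of (q-gauge)-core beyond the KNIT, `hqG`, `T_J`'s divergence row beyond ✓p768852, norm_G, EX, the crux or rung R3 is proved; the Yang–Mills
mass gap is NOT proved.

References: T. Bałaban, CMP **99** (1985) 389–434 [Balaban1985BackgroundPropagators] ((3.13) p.392, (3.14)–(3.16) and (3.19) p.393, (3.114)–(3.115) p.418); CMP **98** (1985) 17–51 [Balaban1985Averaging]
((11) p.19, (97) p.32, Prop. 3 p.36, Prop. 5 (157) p.42); CMP **95** (1984) 17–40 [Balaban1984PropagatorsI] ((1.18) p.20).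
-/

set_option autoImplicit false

noncomputable section

open scoped BigOperators Matrix.Norms.L2Operator Matrix

namespace Summit.QuantumFields.YangMills.Theorems.Prop7AvgHessGaugeT2Letters

open Literature.MathematicalPhysics.QuantumFieldTheory.Balaban1983to89
open Literature.MathematicalPhysics.QuantumFieldTheory.Balaban1983to89.T3ContinuumYM3Torus
open T3PrintedRegularMinimiser (RegPr)
open T3PrintedRegularOrbits (sites_eq)
open T3LevelShift (siteShift bondShift bondShift_src bondShift_tgt)
open T3SectALandauChart (bgUnits eta eta_pos)
open T4Continuum T4ReflectionCone BlockAveraging AveragingRT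
open B5Eq118OneStroke (iterBlockOf)
open B10Eq27TorusAxialLog (holT transl)
open B7Prop1Explicit (disp U1 mem_U1)
open B7TransferAnalyticMean (meanCLM)
open B6BlockDecayHjCovV1 (card_fiber_src_iterBlockOf_le)
open Summit.QuantumFields.YangMills.Theorems.Prop8Chart (emlIterU)
open Summit.QuantumFields.YangMills.Theorems.Prop7SectET3HilbertLetters (toL2 toL2S DL2)
open Summit.QuantumFields.YangMills.Theorems.Prop7SectET3DeltaOne (avgHess)
open Summit.QuantumFields.YangMills.Theorems.Prop7SymAvgTwSym (QTwS)
open Summit.QuantumFields.YangMills.Theorems.Prop7QkPenaltyKernelRow (QTwS_single_eq_zero_of_not_read)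
open Summit.QuantumFields.YangMills.Theorems.Prop7QTwSColumnBound (col_of_regPr col_const_le_five)
open Summit.QuantumFields.YangMills.Theorems.Prop7SymAvgTwSym (emlIterU_bgUnits_mem_U1_of_regPr holT_mem_U1)
open Summit.QuantumFields.YangMills.Theorems.Prop7AvgSeqSpikeMass (sum_norm_avgStep_le)
open Summit.QuantumFields.YangMills.Theorems.Prop7AvgHessGaugeT1Row (sum_norm_src_add_tgt_eq)
open Summit.QuantumFields.YangMills.Theorems.Prop7TJDivGaugeDirDict (hqG_row_of_gaugeDir_column hqG_of_gaugeDir_column_family)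
open Summit.QuantumFields.YangMills.Theorems.Prop7AvgHessGaugeSpikeRowKnit (gaugeDir_column_of_identity_and_letters)

/-! ## §1 `hQrow`: the sup row of the averaging of record -/

section Row

variable (F : T3Family) {n K : ℕ} (h : n ≤ K)

/-- ★★ **THE SUP ROW OF `Q(U₀) = QTwS U₀`** ((3.16) in the unscaled chart): `RegPr F n K ε₀ U₀`, `10¹⁰L⁶ε₀ ≤ 1`, `10¹²L³ε₀ ≤ 1`, `‖Y b‖ ≤ s` for all `b` ⟹ for every coarse bond `c`,
`‖QTwS U₀ Y c‖ ≤ 30·(F.L:ℝ)^(K−n)·s` — the two read blocks (✓`QTwS_single_eq_zero_of_not_read`) carry `≤ 3ℓ³` bonds each ([Balaban1984PropagatorsI] (1.18)), each bond one term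
`≤ 5ℓ⁻²‖Y b‖` of (COL). [cite: Balaban1985BackgroundPropagators, (3.13) p.392, (3.14)–(3.16) p.393; Balaban1984PropagatorsI, (1.18) p.20; Balaban1985Averaging, Prop. 3 p.36] -/
theorem norm_QTwS_apply_le_of_regPr {ε₀ : ℝ} (hε₀ : 0 < ε₀) (hε : 10 ^ 10 * (F.L : ℝ) ^ 6 * ε₀ ≤ 1) (hε12 : 10 ^ 12 * (F.L : ℝ) ^ 3 * ε₀ ≤ 1)
    (U₀ : GaugeField (F.P K) 0 (Matrix.specialUnitaryGroup (Fin 2) ℂ)) (hreg : RegPr F n K ε₀ U₀)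
    (Y : PBond (F.P K) 0 → Matrix (Fin 2) (Fin 2) ℂ) {s : ℝ} (hY : ∀ b, ‖Y b‖ ≤ s) (c : PBond (F.P n) 0) :
    ‖QTwS F n K h U₀ Y c‖ ≤ 30 * (F.L : ℝ) ^ (K - n) * s := by
  classical
  have hL0 : (0 : ℝ) < F.L := by exact_mod_cast lt_trans zero_lt_one F.hL.2
  have hℓ : (0 : ℝ) < (F.L : ℝ) ^ (K - n) := pow_pos hL0 _
  have hs : 0 ≤ s := (norm_nonneg _).trans (hY ⟨default, 0⟩)
  have hk : K - n ≤ (F.P K).m + (F.P K).K := by show K - n ≤ F.m + K; omega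
  -- bond-spike expansion of `Y` under the linear map `QTwS U₀`
  have hsum : QTwS F n K h U₀ Y c = ∑ b' : PBond (F.P K) 0, QTwS F n K h U₀ (Pi.single b' (Y b')) c := by
    conv_lhs => rw [← Finset.univ_sum_single Y]
    rw [map_sum, Finset.sum_apply]
  -- the two blocks read by `c`
  set σ : Site (F.P K) (K - n) := (bondShift (sites_eq F n K h) c).src with hσ
  set τ : Site (F.P K) (K - n) := (bondShift (sites_eq F n K h) c).tgt with hτ
  have hCQ5 := col_const_le_five F (K := K) hε₀ hε
  have hterm : ∀ b' : PBond (F.P K) 0, ‖QTwS F n K h U₀ (Pi.single b' (Y b')) c‖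
      ≤ 5 * ((F.L : ℝ) ^ (K - n))⁻¹ ^ 2 * ((if iterBlockOf (K - n) b'.src = σ then ‖Y b'‖ else 0) + (if iterBlockOf (K - n) b'.src = τ then ‖Y b'‖ else 0)) := by
    intro b'
    by_cases hb' : (iterBlockOf (K - n) b'.src = σ ∨ iterBlockOf (K - n) b'.src = τ)
    · have hone : ‖QTwS F n K h U₀ (Pi.single b' (Y b')) c‖ ≤ 5 * ((F.L : ℝ) ^ (K - n))⁻¹ ^ 2 * ‖Y b'‖ := by
        refine ((Finset.single_le_sum (f := fun c' => ‖QTwS F n K h U₀ (Pi.single b' (Y b')) c'‖) (fun _ _ => norm_nonneg _) (Finset.mem_univ c)).trans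
          (col_of_regPr F h hε₀ hε hε12 U₀ hreg b' (Y b'))).trans ?_
        have hK0 : 0 ≤ ((F.L : ℝ) ^ (K - n))⁻¹ ^ 2 * ‖Y b'‖ := by positivity
        nlinarith [mul_le_mul_of_nonneg_right hCQ5 hK0]
      refine hone.trans (mul_le_mul_of_nonneg_left ?_ (by positivity))
      rcases hb' with hb' | hb'
      · rw [if_pos hb']; have : 0 ≤ (if iterBlockOf (K - n) b'.src = τ then ‖Y b'‖ else 0) := by positivity
        linarith
      · rw [if_pos hb']; have : 0 ≤ (if iterBlockOf (K - n) b'.src = σ then ‖Y b'‖ else 0) := by positivity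
        linarith
    · rw [QTwS_single_eq_zero_of_not_read F h hε₀ hε12 U₀ hreg b' (Y b') c (by rwa [hσ, hτ] at hb'), norm_zero]
      positivity
  -- each read block carries at most `3ℓ³` bonds, each `≤ s`
  have hblk : ∀ y : Site (F.P K) (K - n), ∑ b' : PBond (F.P K) 0, (if iterBlockOf (K - n) b'.src = y then ‖Y b'‖ else 0) ≤ 3 * ((F.L : ℝ) ^ (K - n)) ^ 3 * s := by
    intro y
    calc ∑ b' : PBond (F.P K) 0, (if iterBlockOf (K - n) b'.src = y then ‖Y b'‖ else 0)
        ≤ ∑ b' : PBond (F.P K) 0, (if iterBlockOf (K - n) b'.src = y then s else 0) :=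
          Finset.sum_le_sum fun b' _ => by split_ifs <;> [exact hY b'; exact le_rfl]
      _ = ((Finset.univ.filter fun b' : PBond (F.P K) 0 => iterBlockOf (K - n) b'.src = y).card : ℝ) * s := by
          rw [← Finset.sum_filter, Finset.sum_const, nsmul_eq_mul]
      _ ≤ 3 * ((F.L : ℝ) ^ (K - n)) ^ 3 * s := by
          refine mul_le_mul_of_nonneg_right ?_ hs
          have hc : (((Finset.univ.filter fun b' : PBond (F.P K) 0 => iterBlockOf (K - n) b'.src = y).card : ℕ) : ℝ)
              ≤ ((((F.P K).L ^ (K - n)) ^ (F.P K).d * (F.P K).d : ℕ) : ℝ) := by exact_mod_cast card_fiber_src_iterBlockOf_le hk y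
          refine hc.trans (le_of_eq ?_)
          simp only [T3Family.P_d]
          push_cast
          rw [show ((F.P K).L : ℝ) = (F.L : ℝ) from rfl]
          ring
  rw [hsum]
  refine (norm_sum_le _ _).trans ((Finset.sum_le_sum fun b' _ => hterm b').trans ?_)
  rw [← Finset.mul_sum, Finset.sum_add_distrib]
  have h1 := hblk σ
  have h2 := hblk τ
  have hℓne : ((F.L : ℝ) ^ (K - n)) ≠ 0 := hℓ.ne'
  calc 5 * ((F.L : ℝ) ^ (K - n))⁻¹ ^ 2 * (∑ b' : PBond (F.P K) 0, (if iterBlockOf (K - n) b'.src = σ then ‖Y b'‖ else 0)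
          + ∑ b' : PBond (F.P K) 0, (if iterBlockOf (K - n) b'.src = τ then ‖Y b'‖ else 0))
      ≤ 5 * ((F.L : ℝ) ^ (K - n))⁻¹ ^ 2 * (3 * ((F.L : ℝ) ^ (K - n)) ^ 3 * s + 3 * ((F.L : ℝ) ^ (K - n)) ^ 3 * s) :=
        mul_le_mul_of_nonneg_left (add_le_add h1 h2) (by positivity)
    _ = 30 * (F.L : ℝ) ^ (K - n) * s := by field_simp; ring

/-- ★★ **`hQrow` OF THE KNIT**: the sup norm of `QTwS U₀ Y` is at most `30·(F.L:ℝ)^(K−n)·s` whenever `‖Y b‖ ≤ s` for all `b` (§1 at every coarse bond).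
[cite: Balaban1985BackgroundPropagators, (3.16) p.393; Balaban1984PropagatorsI, (1.18) p.20] -/
theorem norm_QTwS_le_of_regPr {ε₀ : ℝ} (hε₀ : 0 < ε₀) (hε : 10 ^ 10 * (F.L : ℝ) ^ 6 * ε₀ ≤ 1) (hε12 : 10 ^ 12 * (F.L : ℝ) ^ 3 * ε₀ ≤ 1)
    (U₀ : GaugeField (F.P K) 0 (Matrix.specialUnitaryGroup (Fin 2) ℂ)) (hreg : RegPr F n K ε₀ U₀) :
    ∀ (Y : PBond (F.P K) 0 → Matrix (Fin 2) (Fin 2) ℂ) (s : ℝ), (∀ b, ‖Y b‖ ≤ s) → ‖QTwS F n K h U₀ Y‖ ≤ 30 * (F.L : ℝ) ^ (K - n) * s := by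
  intro Y s hY
  have hL0 : (0 : ℝ) < F.L := by exact_mod_cast lt_trans zero_lt_one F.hL.2
  have hs : 0 ≤ s := (norm_nonneg _).trans (hY ⟨default, 0⟩)
  exact (pi_norm_le_iff_of_nonneg (by positivity)).2 fun c => norm_QTwS_apply_le_of_regPr F h hε₀ hε hε12 U₀ hreg Y hY c

end Row

/-! ## §2 `hnK`: the coarse bond-end mass of the averaged site spike -/

section Mass

variable (F : T3Family) {n K : ℕ} (h : n ≤ K)

/-- ★★ **MASS CONTRACTION OF THE AVERAGING SEQUENCE AGAINST THE BACKGROUND TOWER, IN THE STANDING RANGE**: `RegPr F n K ε₀ U₀`, `10¹²L³ε₀ ≤ 1`, and `ns` the averaging sequence of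
(97) against `Ū₀♭ʲ = emlIterU j U₀♭` (the recursion of ✓`QTwS_gaugeDir_of_avgSeq`) ⟹ `Σ_y ‖ns k y‖ ≤ ((L³)⁻¹)^k·Σ_x ‖ns 0 x‖` for every `k ≤ K − n` — ✓`sum_norm_avgStep_le` level by
level, the stair holonomies being `U1`-valued (✓`emlIterU_bgUnits_mem_U1_of_regPr`, ✓`holT_mem_U1`). [cite: Balaban1985Averaging, (11) p.19, (97) p.32; Balaban1985Variational, (2) p.278] -/
theorem sum_norm_avgSeq_le_of_regPr {ε₀ : ℝ} (hε₀ : 0 < ε₀) (hε12 : 10 ^ 12 * (F.L : ℝ) ^ 3 * ε₀ ≤ 1)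
    (U₀ : GaugeField (F.P K) 0 (Matrix.specialUnitaryGroup (Fin 2) ℂ)) (hreg : RegPr F n K ε₀ U₀)
    (ns : (j : ℕ) → Site (F.P K) j → Matrix (Fin 2) (Fin 2) ℂ)
    (hsucc : ∀ (j : ℕ) (y : Site (F.P K) (j + 1)), ns (j + 1) y = ns j (emb y) - meanCLM (Idx (F.P K)) (Matrix (Fin 2) (Fin 2) ℂ) fun r : Idx (F.P K) =>
        ns j (emb y) - ((holT (emlIterU j (bgUnits F K U₀)) (emb y) (stairWord r.2.1 (off r.1)) : (Matrix (Fin 2) (Fin 2) ℂ)ˣ) : Matrix (Fin 2) (Fin 2) ℂ) *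
          ns j (transl (emb y) (disp (stairWord r.2.1 (off r.1)))) * (((holT (emlIterU j (bgUnits F K U₀)) (emb y) (stairWord r.2.1 (off r.1)))⁻¹ : (Matrix (Fin 2) (Fin 2) ℂ)ˣ) : Matrix (Fin 2) (Fin 2) ℂ)) :
    ∀ k : ℕ, k ≤ K - n → ∑ y : Site (F.P K) k, ‖ns k y‖ ≤ ((((F.P K).L : ℝ) ^ (F.P K).d)⁻¹) ^ k * ∑ x : Site (F.P K) 0, ‖ns 0 x‖
  | 0, _ => by rw [pow_zero, one_mul]
  | k + 1, hk => by
    have hε7 : 10 ^ 7 * (F.L : ℝ) ^ 3 * ε₀ ≤ 1 := by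
      have : 0 ≤ (F.L : ℝ) ^ 3 * ε₀ := by positivity
      nlinarith
    have ih := sum_norm_avgSeq_le_of_regPr hε₀ hε12 U₀ hreg ns hsucc k (by omega)
    have hV : ∀ (y : Site (F.P K) (k + 1)) (r : Idx (F.P K)),
        ‖((holT (emlIterU k (bgUnits F K U₀)) (emb y) (stairWord r.2.1 (off r.1)) : (Matrix (Fin 2) (Fin 2) ℂ)ˣ) : Matrix (Fin 2) (Fin 2) ℂ)‖ ≤ 1 ∧
          ‖(((holT (emlIterU k (bgUnits F K U₀)) (emb y) (stairWord r.2.1 (off r.1)))⁻¹ : (Matrix (Fin 2) (Fin 2) ℂ)ˣ) : Matrix (Fin 2) (Fin 2) ℂ)‖ ≤ 1 :=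
      fun y r => mem_U1.1 (holT_mem_U1 (fun b => emlIterU_bgUnits_mem_U1_of_regPr F hε₀ hε7 hreg (by omega : k ≤ K - n) b) _ _)
    have hk' : k + 1 ≤ (F.P K).m + (F.P K).K := by show k + 1 ≤ F.m + K; omega
    have hstep := sum_norm_avgStep_le hk' (emlIterU k (bgUnits F K U₀)) hV (ns k) (ns (k + 1)) (hsucc k)
    have hL : 0 ≤ (((F.P K).L : ℝ) ^ (F.P K).d)⁻¹ := by positivity
    calc ∑ y : Site (F.P K) (k + 1), ‖ns (k + 1) y‖ ≤ (((F.P K).L : ℝ) ^ (F.P K).d)⁻¹ * ∑ x : Site (F.P K) k, ‖ns k x‖ := hstep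
      _ ≤ (((F.P K).L : ℝ) ^ (F.P K).d)⁻¹ * (((((F.P K).L : ℝ) ^ (F.P K).d)⁻¹) ^ k * ∑ x : Site (F.P K) 0, ‖ns 0 x‖) := mul_le_mul_of_nonneg_left ih hL
      _ = ((((F.P K).L : ℝ) ^ (F.P K).d)⁻¹) ^ (k + 1) * ∑ x : Site (F.P K) 0, ‖ns 0 x‖ := by ring

/-- ★★ **`hnK` OF THE KNIT — THE COARSE BOND-END MASS OF THE AVERAGED SITE SPIKE**: for the averaging sequence `ns` of `δ_x ⊗ A` against the background tower (`U₀ ∈ 𝔘_k(ε₀)`,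
`10¹²L³ε₀ ≤ 1`), `Σ_{c : PBond (F.P n) 0} (‖ns (K−n) ĉ.src‖ + ‖ns (K−n) ĉ.tgt‖) ≤ 6·((F.L:ℝ)^(K−n))⁻¹^3·‖A‖` (`ĉ = bondShift c`): each coarse site ends `6` coarse bonds and the top mass is
`ℓ⁻³‖A‖`. [cite: Balaban1985Averaging, (11) p.19, (97) p.32; Balaban1985BackgroundPropagators, (3.19) p.393, (3.115) p.418] -/
theorem hnK_of_avgSeq_spike_of_regPr {ε₀ : ℝ} (hε₀ : 0 < ε₀) (hε12 : 10 ^ 12 * (F.L : ℝ) ^ 3 * ε₀ ≤ 1)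
    (U₀ : GaugeField (F.P K) 0 (Matrix.specialUnitaryGroup (Fin 2) ℂ)) (hreg : RegPr F n K ε₀ U₀)
    (x : Site (F.P K) 0) (A : Matrix (Fin 2) (Fin 2) ℂ) (ns : (j : ℕ) → Site (F.P K) j → Matrix (Fin 2) (Fin 2) ℂ) (h0 : ns 0 = Pi.single x A)
    (hsucc : ∀ (j : ℕ) (y : Site (F.P K) (j + 1)), ns (j + 1) y = ns j (emb y) - meanCLM (Idx (F.P K)) (Matrix (Fin 2) (Fin 2) ℂ) fun r : Idx (F.P K) =>
        ns j (emb y) - ((holT (emlIterU j (bgUnits F K U₀)) (emb y) (stairWord r.2.1 (off r.1)) : (Matrix (Fin 2) (Fin 2) ℂ)ˣ) : Matrix (Fin 2) (Fin 2) ℂ) *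
          ns j (transl (emb y) (disp (stairWord r.2.1 (off r.1)))) * (((holT (emlIterU j (bgUnits F K U₀)) (emb y) (stairWord r.2.1 (off r.1)))⁻¹ : (Matrix (Fin 2) (Fin 2) ℂ)ˣ) : Matrix (Fin 2) (Fin 2) ℂ)) :
    ∑ c : PBond (F.P n) 0, (‖ns (K - n) (bondShift (sites_eq F n K h) c).src‖ + ‖ns (K - n) (bondShift (sites_eq F n K h) c).tgt‖)
      ≤ 6 * ((F.L : ℝ) ^ (K - n))⁻¹ ^ 3 * ‖A‖ := by
  -- the bond-end sum on the member `F.P n` is `2·3` times the site sum, carried along `siteShift`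
  have hends : ∑ c : PBond (F.P n) 0, (‖ns (K - n) (bondShift (sites_eq F n K h) c).src‖ + ‖ns (K - n) (bondShift (sites_eq F n K h) c).tgt‖)
      = 2 * 3 * ∑ z : Site (F.P K) (K - n), ‖ns (K - n) z‖ := by
    have h1 : ∀ c : PBond (F.P n) 0, ‖ns (K - n) (bondShift (sites_eq F n K h) c).src‖ + ‖ns (K - n) (bondShift (sites_eq F n K h) c).tgt‖
        = ‖(fun y : Site (F.P n) 0 => ns (K - n) (siteShift (sites_eq F n K h) y)) c.src‖ + ‖(fun y : Site (F.P n) 0 => ns (K - n) (siteShift (sites_eq F n K h) y)) c.tgt‖ := by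
      intro c; rw [bondShift_src, bondShift_tgt]; exact rfl
    rw [Finset.sum_congr rfl fun c _ => h1 c, sum_norm_src_add_tgt_eq (F := F) (K := n) (fun y : Site (F.P n) 0 => ns (K - n) (siteShift (sites_eq F n K h) y))]
    congr 1
    exact Equiv.sum_comp (siteShift (sites_eq F n K h)) (fun z => ‖ns (K - n) z‖)
  -- the top mass of the spike
  have hmass0 : ∑ z : Site (F.P K) 0, ‖ns 0 z‖ = ‖A‖ := by
    rw [h0, Finset.sum_eq_single x]
    · rw [Pi.single_eq_same]
    · intro z _ hz; rw [Pi.single_eq_of_ne hz, norm_zero]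
    · intro hx; exact absurd (Finset.mem_univ x) hx
  have htop := sum_norm_avgSeq_le_of_regPr F hε₀ hε12 U₀ hreg ns hsucc (K - n) le_rfl
  rw [hmass0] at htop
  have hd : (F.P K).d = 3 := T3Family.P_d F K
  have hLL : ((F.P K).L : ℝ) = F.L := rfl
  rw [hd, hLL] at htop
  have hpow : ((((F.L : ℝ)) ^ 3)⁻¹) ^ (K - n) = ((F.L : ℝ) ^ (K - n))⁻¹ ^ 3 := by
    rw [← inv_pow, ← inv_pow, ← pow_mul, ← pow_mul, mul_comm]
  rw [hpow] at htop
  rw [hends]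
  have h6 : (2 : ℝ) * 3 = 6 := by norm_num
  rw [h6]
  calc 6 * ∑ z : Site (F.P K) (K - n), ‖ns (K - n) z‖ ≤ 6 * (((F.L : ℝ) ^ (K - n))⁻¹ ^ 3 * ‖A‖) := mul_le_mul_of_nonneg_left htop (by norm_num)
    _ = 6 * ((F.L : ℝ) ^ (K - n))⁻¹ ^ 3 * ‖A‖ := by ring

end Mass

/-! ## §3 The KNIT with (T1), (T2) discharged: the core column and `hqG`'s member text from `hId` + «FR₂-lite» alone -/

section Knit

variable {F : T3Family} {n K : ℕ} {h : n ≤ K} {c₀ : ℝ} [Fact (0 < c₀)]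

/-- ★★★ **THE (q-gauge)-CORE COLUMN FROM S1-SPEC (2) (CONCRETE CURRENCY) AND «FR₂-lite» ALONE**: `U₀ ∈ 𝔘_k(ε₀)` in the (COL) windows; `ns x A` the averaging sequence of the site
spike `δ_x ⊗ A` against the background tower ((97); inhabited by the recursion); `MK` the (T3) letter with `MK Y x A ≤ C₃·ℓ⁻²·s·‖A‖` («FR₂-lite», OPEN); and `hId` — S1-SPEC (2) read in
norm: the coarse column of `avgHess U₀ Y (gd(δ_xA))` is at most the `QTwS`-column of the commutator field + `‖QTwS U₀ Y‖_∞ · Σ_c (‖ns(ĉ₋)‖ + ‖ns(ĉ₊)‖)` + `MK Y x A` (OPEN: the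
`Y`-derivative of ✓`Prop7ChartGaugeCovarianceDeriv` at `A = 0`).  THEN `Σ_y ‖avgHess U₀ Y (gd(δ_xA)) y‖ ≤ (240 + C₃)·((F.L:ℝ)^(K−n))⁻¹^2·s·‖A‖` — ✓`gaugeDir_column_of_identity_and_letters`
with `hQrow := §1` (`CQ′ = 30`), `hnK := §2`, `c_W = 1`, and `12·C_Q ≤ 60` (✓`col_const_le_five`).
[cite: Balaban1985BackgroundPropagators, (3.114)–(3.115) p.418, (3.16) p.393, (3.19) p.393; Balaban1985Averaging, (97) p.32, Prop. 5 (157) p.42] -/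
theorem gaugeDir_column_of_identity_and_FR2 {ε₀ : ℝ} (hε₀ : 0 < ε₀) (hε : 10 ^ 10 * (F.L : ℝ) ^ 6 * ε₀ ≤ 1) (hε12 : 10 ^ 12 * (F.L : ℝ) ^ 3 * ε₀ ≤ 1)
    (U₀ : GaugeField (F.P K) 0 (Matrix.specialUnitaryGroup (Fin 2) ℂ)) (hreg : RegPr F n K ε₀ U₀)
    (ns : Site (F.P K) 0 → Matrix (Fin 2) (Fin 2) ℂ → (j : ℕ) → Site (F.P K) j → Matrix (Fin 2) (Fin 2) ℂ)
    (h0 : ∀ (x : Site (F.P K) 0) (A : Matrix (Fin 2) (Fin 2) ℂ), ns x A 0 = Pi.single x A)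
    (hsucc : ∀ (x : Site (F.P K) 0) (A : Matrix (Fin 2) (Fin 2) ℂ) (j : ℕ) (y : Site (F.P K) (j + 1)), ns x A (j + 1) y = ns x A j (emb y) - meanCLM (Idx (F.P K)) (Matrix (Fin 2) (Fin 2) ℂ) fun r : Idx (F.P K) =>
        ns x A j (emb y) - ((holT (emlIterU j (bgUnits F K U₀)) (emb y) (stairWord r.2.1 (off r.1)) : (Matrix (Fin 2) (Fin 2) ℂ)ˣ) : Matrix (Fin 2) (Fin 2) ℂ) *
          ns x A j (transl (emb y) (disp (stairWord r.2.1 (off r.1)))) * (((holT (emlIterU j (bgUnits F K U₀)) (emb y) (stairWord r.2.1 (off r.1)))⁻¹ : (Matrix (Fin 2) (Fin 2) ℂ)ˣ) : Matrix (Fin 2) (Fin 2) ℂ))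
    {C₃ : ℝ} (MK : (PBond (F.P K) 0 → Matrix (Fin 2) (Fin 2) ℂ) → Site (F.P K) 0 → Matrix (Fin 2) (Fin 2) ℂ → ℝ)
    (hκY : ∀ (Y : PBond (F.P K) 0 → Matrix (Fin 2) (Fin 2) ℂ) (s : ℝ) (x : Site (F.P K) 0) (A : Matrix (Fin 2) (Fin 2) ℂ), (∀ b, ‖Y b‖ ≤ s) →
      MK Y x A ≤ C₃ * ((F.L : ℝ) ^ (K - n))⁻¹ ^ 2 * s * ‖A‖)
    (hId : ∀ (Y : PBond (F.P K) 0 → Matrix (Fin 2) (Fin 2) ℂ) (x : Site (F.P K) 0) (A : Matrix (Fin 2) (Fin 2) ℂ),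
      ∑ c : PBond (F.P n) 0, ‖avgHess F n K h U₀ Y (fun b : PBond (F.P K) 0 =>
          (Pi.single x A : Site (F.P K) 0 → Matrix (Fin 2) (Fin 2) ℂ) b.src
            - ((bgUnits F K U₀ b : (Matrix (Fin 2) (Fin 2) ℂ)ˣ) : Matrix (Fin 2) (Fin 2) ℂ) * (Pi.single x A : Site (F.P K) 0 → Matrix (Fin 2) (Fin 2) ℂ) b.tgt
              * (((bgUnits F K U₀ b)⁻¹ : (Matrix (Fin 2) (Fin 2) ℂ)ˣ) : Matrix (Fin 2) (Fin 2) ℂ)) c‖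
        ≤ ∑ c : PBond (F.P n) 0, ‖QTwS F n K h U₀ (fun b : PBond (F.P K) 0 =>
            ((Pi.single x A : Site (F.P K) 0 → Matrix (Fin 2) (Fin 2) ℂ) b.src
                + ((bgUnits F K U₀ b : (Matrix (Fin 2) (Fin 2) ℂ)ˣ) : Matrix (Fin 2) (Fin 2) ℂ) * (Pi.single x A : Site (F.P K) 0 → Matrix (Fin 2) (Fin 2) ℂ) b.tgt
                  * (((bgUnits F K U₀ b)⁻¹ : (Matrix (Fin 2) (Fin 2) ℂ)ˣ) : Matrix (Fin 2) (Fin 2) ℂ)) * Y b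
              - Y b * ((Pi.single x A : Site (F.P K) 0 → Matrix (Fin 2) (Fin 2) ℂ) b.src
                + ((bgUnits F K U₀ b : (Matrix (Fin 2) (Fin 2) ℂ)ˣ) : Matrix (Fin 2) (Fin 2) ℂ) * (Pi.single x A : Site (F.P K) 0 → Matrix (Fin 2) (Fin 2) ℂ) b.tgt
                  * (((bgUnits F K U₀ b)⁻¹ : (Matrix (Fin 2) (Fin 2) ℂ)ˣ) : Matrix (Fin 2) (Fin 2) ℂ))) c‖
          + ‖QTwS F n K h U₀ Y‖ * (∑ c : PBond (F.P n) 0, (‖ns x A (K - n) (bondShift (sites_eq F n K h) c).src‖ + ‖ns x A (K - n) (bondShift (sites_eq F n K h) c).tgt‖)) + MK Y x A)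
    (Y : PBond (F.P K) 0 → Matrix (Fin 2) (Fin 2) ℂ) (s : ℝ) (x : Site (F.P K) 0) (A : Matrix (Fin 2) (Fin 2) ℂ) (hY : ∀ b, ‖Y b‖ ≤ s) :
    ∑ c : PBond (F.P n) 0, ‖avgHess F n K h U₀ Y (fun b : PBond (F.P K) 0 =>
          (Pi.single x A : Site (F.P K) 0 → Matrix (Fin 2) (Fin 2) ℂ) b.src
            - ((bgUnits F K U₀ b : (Matrix (Fin 2) (Fin 2) ℂ)ˣ) : Matrix (Fin 2) (Fin 2) ℂ) * (Pi.single x A : Site (F.P K) 0 → Matrix (Fin 2) (Fin 2) ℂ) b.tgt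
              * (((bgUnits F K U₀ b)⁻¹ : (Matrix (Fin 2) (Fin 2) ℂ)ˣ) : Matrix (Fin 2) (Fin 2) ℂ)) c‖
      ≤ (240 + C₃) * ((F.L : ℝ) ^ (K - n))⁻¹ ^ 2 * s * ‖A‖ := by
  have hs : 0 ≤ s := (norm_nonneg _).trans (hY ⟨x, 0⟩)
  have hCQ5 := col_const_le_five F (K := K) hε₀ hε
  have hmain := gaugeDir_column_of_identity_and_letters (h := h) hε₀ hε hε12 U₀ hreg (cW := 1) (CQ' := 30) (C₃ := C₃) zero_le_one (by norm_num)
    (fun Y => ‖QTwS F n K h U₀ Y‖) (fun x A => (∑ c : PBond (F.P n) 0, (‖ns x A (K - n) (bondShift (sites_eq F n K h) c).src‖ + ‖ns x A (K - n) (bondShift (sites_eq F n K h) c).tgt‖))) MK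
    (norm_QTwS_le_of_regPr F h hε₀ hε hε12 U₀ hreg)
    (fun x A => hnK_of_avgSeq_spike_of_regPr F h hε₀ hε12 U₀ hreg x A (ns x A) (h0 x A) (hsucc x A)) hκY
    (fun Y x A _ => (hId Y x A).trans (le_of_eq (by ring))) Y s x A hY (by positivity)
  refine hmain.trans ?_
  have hX0 : 0 ≤ ((F.L : ℝ) ^ (K - n))⁻¹ ^ 2 * s * ‖A‖ := by positivity
  have hc : 12 * (Real.sqrt 2 * (2 * Real.exp ((159 * ((((F.P K).d + 2) * (F.P K).L : ℕ) : ℝ) * (2 * ((F.P K).d : ℝ)))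
              / ((((F.P K).L : ℝ) ^ (F.P K).d)⁻¹ * ((F.P K).L : ℝ)) * (((((F.P K).d + 2) * (F.P K).L : ℕ) : ℝ) ^ 2 / 16 * ε₀)) + 1))
          + 6 * 1 * 30 + C₃ ≤ 240 + C₃ := by linarith
  calc _ = (12 * (Real.sqrt 2 * (2 * Real.exp ((159 * ((((F.P K).d + 2) * (F.P K).L : ℕ) : ℝ) * (2 * ((F.P K).d : ℝ)))
              / ((((F.P K).L : ℝ) ^ (F.P K).d)⁻¹ * ((F.P K).L : ℝ)) * (((((F.P K).d + 2) * (F.P K).L : ℕ) : ℝ) ^ 2 / 16 * ε₀)) + 1))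
          + 6 * 1 * 30 + C₃) * (((F.L : ℝ) ^ (K - n))⁻¹ ^ 2 * s * ‖A‖) := by ring
    _ ≤ (240 + C₃) * (((F.L : ℝ) ^ (K - n))⁻¹ ^ 2 * s * ‖A‖) := mul_le_mul_of_nonneg_right hc hX0
    _ = (240 + C₃) * ((F.L : ℝ) ^ (K - n))⁻¹ ^ 2 * s * ‖A‖ := by ring

/-- ★★★ **✓p768852's MEMBER ROW `hQG` FROM S1-SPEC (2) (CONCRETE) AND «FR₂-lite» ALONE**: §3 ∘ ✓`Prop7TJDivGaugeDirDict.hqG_row_of_gaugeDir_column` — for every bounded `X′` and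
site spike, `Σ_y ‖avgHess U₀ X′ (toL2⁻¹(D_{U₀}(toL2S(δ_xA)))) y‖ ≤ η⁻¹·((240 + C₃)·ℓ⁻²)·s′·‖A‖` (`= (240 + C₃)·ℓ⁻¹·s′·‖A‖`, the supplier currency of ✓`hTJdiv_of_hHcol_hqG`).
[cite: Balaban1985BackgroundPropagators, (3.114)–(3.115) p.418, (3.19) p.393; Balaban1985Averaging, Prop. 5 (157) p.42] -/
theorem hqG_member_of_identity_and_FR2 {ε₀ : ℝ} (hε₀ : 0 < ε₀) (hε : 10 ^ 10 * (F.L : ℝ) ^ 6 * ε₀ ≤ 1) (hε12 : 10 ^ 12 * (F.L : ℝ) ^ 3 * ε₀ ≤ 1)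
    (U₀ : GaugeField (F.P K) 0 (Matrix.specialUnitaryGroup (Fin 2) ℂ)) (hreg : RegPr F n K ε₀ U₀)
    (ns : Site (F.P K) 0 → Matrix (Fin 2) (Fin 2) ℂ → (j : ℕ) → Site (F.P K) j → Matrix (Fin 2) (Fin 2) ℂ)
    (h0 : ∀ (x : Site (F.P K) 0) (A : Matrix (Fin 2) (Fin 2) ℂ), ns x A 0 = Pi.single x A)
    (hsucc : ∀ (x : Site (F.P K) 0) (A : Matrix (Fin 2) (Fin 2) ℂ) (j : ℕ) (y : Site (F.P K) (j + 1)), ns x A (j + 1) y = ns x A j (emb y) - meanCLM (Idx (F.P K)) (Matrix (Fin 2) (Fin 2) ℂ) fun r : Idx (F.P K) =>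
        ns x A j (emb y) - ((holT (emlIterU j (bgUnits F K U₀)) (emb y) (stairWord r.2.1 (off r.1)) : (Matrix (Fin 2) (Fin 2) ℂ)ˣ) : Matrix (Fin 2) (Fin 2) ℂ) *
          ns x A j (transl (emb y) (disp (stairWord r.2.1 (off r.1)))) * (((holT (emlIterU j (bgUnits F K U₀)) (emb y) (stairWord r.2.1 (off r.1)))⁻¹ : (Matrix (Fin 2) (Fin 2) ℂ)ˣ) : Matrix (Fin 2) (Fin 2) ℂ))
    {C₃ : ℝ} (MK : (PBond (F.P K) 0 → Matrix (Fin 2) (Fin 2) ℂ) → Site (F.P K) 0 → Matrix (Fin 2) (Fin 2) ℂ → ℝ)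
    (hκY : ∀ (Y : PBond (F.P K) 0 → Matrix (Fin 2) (Fin 2) ℂ) (s : ℝ) (x : Site (F.P K) 0) (A : Matrix (Fin 2) (Fin 2) ℂ), (∀ b, ‖Y b‖ ≤ s) →
      MK Y x A ≤ C₃ * ((F.L : ℝ) ^ (K - n))⁻¹ ^ 2 * s * ‖A‖)
    (hId : ∀ (Y : PBond (F.P K) 0 → Matrix (Fin 2) (Fin 2) ℂ) (x : Site (F.P K) 0) (A : Matrix (Fin 2) (Fin 2) ℂ),
      ∑ c : PBond (F.P n) 0, ‖avgHess F n K h U₀ Y (fun b : PBond (F.P K) 0 =>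
          (Pi.single x A : Site (F.P K) 0 → Matrix (Fin 2) (Fin 2) ℂ) b.src
            - ((bgUnits F K U₀ b : (Matrix (Fin 2) (Fin 2) ℂ)ˣ) : Matrix (Fin 2) (Fin 2) ℂ) * (Pi.single x A : Site (F.P K) 0 → Matrix (Fin 2) (Fin 2) ℂ) b.tgt
              * (((bgUnits F K U₀ b)⁻¹ : (Matrix (Fin 2) (Fin 2) ℂ)ˣ) : Matrix (Fin 2) (Fin 2) ℂ)) c‖
        ≤ ∑ c : PBond (F.P n) 0, ‖QTwS F n K h U₀ (fun b : PBond (F.P K) 0 =>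
            ((Pi.single x A : Site (F.P K) 0 → Matrix (Fin 2) (Fin 2) ℂ) b.src
                + ((bgUnits F K U₀ b : (Matrix (Fin 2) (Fin 2) ℂ)ˣ) : Matrix (Fin 2) (Fin 2) ℂ) * (Pi.single x A : Site (F.P K) 0 → Matrix (Fin 2) (Fin 2) ℂ) b.tgt
                  * (((bgUnits F K U₀ b)⁻¹ : (Matrix (Fin 2) (Fin 2) ℂ)ˣ) : Matrix (Fin 2) (Fin 2) ℂ)) * Y b
              - Y b * ((Pi.single x A : Site (F.P K) 0 → Matrix (Fin 2) (Fin 2) ℂ) b.src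
                + ((bgUnits F K U₀ b : (Matrix (Fin 2) (Fin 2) ℂ)ˣ) : Matrix (Fin 2) (Fin 2) ℂ) * (Pi.single x A : Site (F.P K) 0 → Matrix (Fin 2) (Fin 2) ℂ) b.tgt
                  * (((bgUnits F K U₀ b)⁻¹ : (Matrix (Fin 2) (Fin 2) ℂ)ˣ) : Matrix (Fin 2) (Fin 2) ℂ))) c‖
          + ‖QTwS F n K h U₀ Y‖ * (∑ c : PBond (F.P n) 0, (‖ns x A (K - n) (bondShift (sites_eq F n K h) c).src‖ + ‖ns x A (K - n) (bondShift (sites_eq F n K h) c).tgt‖)) + MK Y x A) :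
    ∀ (X' : PBond (F.P K) 0 → Matrix (Fin 2) (Fin 2) ℂ) (s' : ℝ) (x : Site (F.P K) 0) (A : Matrix (Fin 2) (Fin 2) ℂ), (∀ b, ‖X' b‖ ≤ s') →
      ∑ y : PBond (F.P n) 0, ‖avgHess F n K h U₀ X' ((toL2 F K c₀).symm (DL2 F n K c₀ U₀ (toL2S F K c₀ (Pi.single x A)))) y‖
        ≤ (eta F n K)⁻¹ * ((240 + C₃) * ((F.L : ℝ) ^ (K - n))⁻¹ ^ 2) * s' * ‖A‖ :=
  hqG_row_of_gaugeDir_column (h := h) (c₀ := c₀) U₀ (fun X' s' x A hX' =>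
    gaugeDir_column_of_identity_and_FR2 (h := h) hε₀ hε hε12 U₀ hreg ns h0 hsucc MK hκY hId X' s' x A hX')

end Knit

/-! ## §4 ✓p768852's DISPLAYED family hypothesis `hqG`, VERBATIM, from the per-member letters -/

section Family

/-- ★★★ **`hqG` OF ✓`Prop7TJDivRowOfColumns.hTJdiv_of_hHcol_hqG` — VERBATIM, with `qG L := 240 + C₃ L` — FROM THE PER-MEMBER LETTERS `hId` (S1-SPEC (2), concrete) AND `hκY`
(«FR₂-lite», constant `C₃ L`)**: at every member `i : Idx L` (`1 < L`) and every `U₀ ∈ 𝔘_k(α L)` in the (COL) windows `10¹⁰L⁶α L ≤ 1`, `10¹²L³α L ≤ 1`, §3 gives the core column with the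
L-ONLY constant `240 + C₃ L`, and ✓`Prop7TJDivGaugeDirDict.hqG_of_gaugeDir_column_family` turns it into the displayed row (`η⁻¹·ℓ⁻² = ℓ⁻¹`).  K-FREE iff `C₃` is.
[cite: Balaban1985BackgroundPropagators, (3.114)–(3.115) p.418, (3.16) p.393, (3.19) p.393; Balaban1985Averaging, (97) p.32, Prop. 5 (157) p.42] -/
theorem hqG_of_identity_and_FR2_family (α : ℕ → ℝ) (c₀ : ℕ → ℝ) [hc₀ : ∀ L : ℕ, Fact (0 < c₀ L)]
    (hα0 : ∀ L : ℕ, 1 < L → 0 < α L) (hα10 : ∀ L : ℕ, 1 < L → 10 ^ 10 * (L : ℝ) ^ 6 * α L ≤ 1) (hα12 : ∀ L : ℕ, 1 < L → 10 ^ 12 * (L : ℝ) ^ 3 * α L ≤ 1)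
    (ns : (L : ℕ) → (i : T3Thm1Carrier.Idx L) → GaugeField (i.1.1.P i.1.2.2) 0 (Matrix.specialUnitaryGroup (Fin 2) ℂ) →
      Site (i.1.1.P i.1.2.2) 0 → Matrix (Fin 2) (Fin 2) ℂ → (j : ℕ) → Site (i.1.1.P i.1.2.2) j → Matrix (Fin 2) (Fin 2) ℂ)
    (h0 : ∀ (L : ℕ) (i : T3Thm1Carrier.Idx L) (U₀ : GaugeField (i.1.1.P i.1.2.2) 0 (Matrix.specialUnitaryGroup (Fin 2) ℂ)) (x : Site (i.1.1.P i.1.2.2) 0) (A : Matrix (Fin 2) (Fin 2) ℂ),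
      ns L i U₀ x A 0 = Pi.single x A)
    (hsucc : ∀ (L : ℕ) (i : T3Thm1Carrier.Idx L) (U₀ : GaugeField (i.1.1.P i.1.2.2) 0 (Matrix.specialUnitaryGroup (Fin 2) ℂ)) (x : Site (i.1.1.P i.1.2.2) 0) (A : Matrix (Fin 2) (Fin 2) ℂ)
      (j : ℕ) (y : Site (i.1.1.P i.1.2.2) (j + 1)), ns L i U₀ x A (j + 1) y = ns L i U₀ x A j (emb y) - meanCLM (Idx (i.1.1.P i.1.2.2)) (Matrix (Fin 2) (Fin 2) ℂ) fun r : Idx (i.1.1.P i.1.2.2) =>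
        ns L i U₀ x A j (emb y) - ((holT (emlIterU j (bgUnits i.1.1 i.1.2.2 U₀)) (emb y) (stairWord r.2.1 (off r.1)) : (Matrix (Fin 2) (Fin 2) ℂ)ˣ) : Matrix (Fin 2) (Fin 2) ℂ) *
          ns L i U₀ x A j (transl (emb y) (disp (stairWord r.2.1 (off r.1)))) * (((holT (emlIterU j (bgUnits i.1.1 i.1.2.2 U₀)) (emb y) (stairWord r.2.1 (off r.1)))⁻¹ : (Matrix (Fin 2) (Fin 2) ℂ)ˣ) : Matrix (Fin 2) (Fin 2) ℂ))
    (C₃ : ℕ → ℝ)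
    (MK : (L : ℕ) → (i : T3Thm1Carrier.Idx L) → GaugeField (i.1.1.P i.1.2.2) 0 (Matrix.specialUnitaryGroup (Fin 2) ℂ) →
      (PBond (i.1.1.P i.1.2.2) 0 → Matrix (Fin 2) (Fin 2) ℂ) → Site (i.1.1.P i.1.2.2) 0 → Matrix (Fin 2) (Fin 2) ℂ → ℝ)
    (hκY : ∀ (L : ℕ), 1 < L → ∀ (i : T3Thm1Carrier.Idx L) (U₀ : GaugeField (i.1.1.P i.1.2.2) 0 (Matrix.specialUnitaryGroup (Fin 2) ℂ)), RegPr i.1.1 i.1.2.1 i.1.2.2 (α L) U₀ →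
      ∀ (Y : PBond (i.1.1.P i.1.2.2) 0 → Matrix (Fin 2) (Fin 2) ℂ) (s : ℝ) (x : Site (i.1.1.P i.1.2.2) 0) (A : Matrix (Fin 2) (Fin 2) ℂ), (∀ b, ‖Y b‖ ≤ s) →
        MK L i U₀ Y x A ≤ C₃ L * ((L : ℝ) ^ (i.1.2.2 - i.1.2.1))⁻¹ ^ 2 * s * ‖A‖)
    (hId : ∀ (L : ℕ), 1 < L → ∀ (i : T3Thm1Carrier.Idx L) (U₀ : GaugeField (i.1.1.P i.1.2.2) 0 (Matrix.specialUnitaryGroup (Fin 2) ℂ)), RegPr i.1.1 i.1.2.1 i.1.2.2 (α L) U₀ →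
      ∀ (Y : PBond (i.1.1.P i.1.2.2) 0 → Matrix (Fin 2) (Fin 2) ℂ) (x : Site (i.1.1.P i.1.2.2) 0) (A : Matrix (Fin 2) (Fin 2) ℂ),
      ∑ c : PBond (i.1.1.P i.1.2.1) 0, ‖avgHess i.1.1 i.1.2.1 i.1.2.2 i.2.2.le U₀ Y (fun b : PBond (i.1.1.P i.1.2.2) 0 =>
          (Pi.single x A : Site (i.1.1.P i.1.2.2) 0 → Matrix (Fin 2) (Fin 2) ℂ) b.src
            - ((bgUnits i.1.1 i.1.2.2 U₀ b : (Matrix (Fin 2) (Fin 2) ℂ)ˣ) : Matrix (Fin 2) (Fin 2) ℂ) * (Pi.single x A : Site (i.1.1.P i.1.2.2) 0 → Matrix (Fin 2) (Fin 2) ℂ) b.tgt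
              * (((bgUnits i.1.1 i.1.2.2 U₀ b)⁻¹ : (Matrix (Fin 2) (Fin 2) ℂ)ˣ) : Matrix (Fin 2) (Fin 2) ℂ)) c‖
        ≤ ∑ c : PBond (i.1.1.P i.1.2.1) 0, ‖QTwS i.1.1 i.1.2.1 i.1.2.2 i.2.2.le U₀ (fun b : PBond (i.1.1.P i.1.2.2) 0 =>
            ((Pi.single x A : Site (i.1.1.P i.1.2.2) 0 → Matrix (Fin 2) (Fin 2) ℂ) b.src
                + ((bgUnits i.1.1 i.1.2.2 U₀ b : (Matrix (Fin 2) (Fin 2) ℂ)ˣ) : Matrix (Fin 2) (Fin 2) ℂ) * (Pi.single x A : Site (i.1.1.P i.1.2.2) 0 → Matrix (Fin 2) (Fin 2) ℂ) b.tgt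
                  * (((bgUnits i.1.1 i.1.2.2 U₀ b)⁻¹ : (Matrix (Fin 2) (Fin 2) ℂ)ˣ) : Matrix (Fin 2) (Fin 2) ℂ)) * Y b
              - Y b * ((Pi.single x A : Site (i.1.1.P i.1.2.2) 0 → Matrix (Fin 2) (Fin 2) ℂ) b.src
                + ((bgUnits i.1.1 i.1.2.2 U₀ b : (Matrix (Fin 2) (Fin 2) ℂ)ˣ) : Matrix (Fin 2) (Fin 2) ℂ) * (Pi.single x A : Site (i.1.1.P i.1.2.2) 0 → Matrix (Fin 2) (Fin 2) ℂ) b.tgt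
                  * (((bgUnits i.1.1 i.1.2.2 U₀ b)⁻¹ : (Matrix (Fin 2) (Fin 2) ℂ)ˣ) : Matrix (Fin 2) (Fin 2) ℂ))) c‖
          + ‖QTwS i.1.1 i.1.2.1 i.1.2.2 i.2.2.le U₀ Y‖ * (∑ c : PBond (i.1.1.P i.1.2.1) 0, (‖ns L i U₀ x A (i.1.2.2 - i.1.2.1) (bondShift (sites_eq i.1.1 i.1.2.1 i.1.2.2 i.2.2.le) c).src‖ + ‖ns L i U₀ x A (i.1.2.2 - i.1.2.1) (bondShift (sites_eq i.1.1 i.1.2.1 i.1.2.2 i.2.2.le) c).tgt‖)) + MK L i U₀ Y x A) :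
    ∀ (L : ℕ), 1 < L → ∀ (i : T3Thm1Carrier.Idx L) (U₀ : GaugeField (i.1.1.P i.1.2.2) 0 (Matrix.specialUnitaryGroup (Fin 2) ℂ)), RegPr i.1.1 i.1.2.1 i.1.2.2 (α L) U₀ →
      ∀ (X' : PBond (i.1.1.P i.1.2.2) 0 → Matrix (Fin 2) (Fin 2) ℂ) (s : ℝ) (x : Site (i.1.1.P i.1.2.2) 0) (A : Matrix (Fin 2) (Fin 2) ℂ), (∀ b, ‖X' b‖ ≤ s) →
        ∑ y : PBond (i.1.1.P i.1.2.1) 0, ‖avgHess i.1.1 i.1.2.1 i.1.2.2 i.2.2.le U₀ X'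
            ((toL2 i.1.1 i.1.2.2 (c₀ L)).symm (DL2 i.1.1 i.1.2.1 i.1.2.2 (c₀ L) U₀ (toL2S i.1.1 i.1.2.2 (c₀ L) (Pi.single x A)))) y‖
          ≤ (240 + C₃ L) * ((L : ℝ) ^ (i.1.2.2 - i.1.2.1))⁻¹ * s * ‖A‖ := by
  refine hqG_of_gaugeDir_column_family α (fun L => 240 + C₃ L) c₀ fun L hL i U₀ hU X' s x A hX' => ?_
  have hLi : (i.1.1.L : ℝ) = (L : ℝ) := by exact_mod_cast i.2.1
  have hε : 10 ^ 10 * (i.1.1.L : ℝ) ^ 6 * α L ≤ 1 := by rw [hLi]; exact hα10 L hL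
  have hε12 : 10 ^ 12 * (i.1.1.L : ℝ) ^ 3 * α L ≤ 1 := by rw [hLi]; exact hα12 L hL
  have hcol := gaugeDir_column_of_identity_and_FR2 (h := i.2.2.le) (hα0 L hL) hε hε12 U₀ hU (ns L i U₀) (h0 L i U₀) (hsucc L i U₀) (MK L i U₀)
    (fun Y s x A hY => by rw [hLi]; exact hκY L hL i U₀ hU Y s x A hY) (hId L hL i U₀ hU) X' s x A hX'
  rw [hLi] at hcol
  exact hcol

end Family

end Summit.QuantumFields.YangMills.Theorems.Prop7AvgHessGaugeT2Letters

end
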